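import Summits.BirchSwinnertonDyer.BirchSwinnertonDyer.Theorems.EisensteinPrimesX2TowerBudgetTorsion
import HarnessLib

/-!
# The TOWER budget with rational `p`-torsion at a multiplicative Eisenstein prime, II: the layer
# torsion certificate DISCHARGED (`E(ℚ_n)[p^∞] = E(ℚ)[p^∞]` at `p ‖ N`) and the budget
# `AlgebraicLambdaGE W p (Σ_v p^{min(n,m_v)} − pⁿm' − 2·v_p(#E(ℚ)_tors))` from census data alone
# (route `EisensteinPrimes`, crux 3 `MazurMCOnCellB` = stmt-BirchSwinnertonDyer-19033, line `mudescent`,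
# stub `stub_lambdaCount_offLocus`, ALGEBRAIC half; LEAD seat bsd-line-x2-p1, D-0154 row 5)

HONEST FRAMING (cell `bsd-eis`; nothing here proves BSD or a main conjecture; 0 cells move): THEOREMS
ONLY — no definition, no named fact, nothing asserted about any particular curve, closes nothing.
Sequel of `Theorems/EisensteinPrimesX2TowerBudgetTorsion.lean` (p608923): there the layer-`n` count
`Σ_{v∈S} p^{min(n,m_v)} ≤ λ + pⁿμ + 2k` carried the layer torsion certificate `#E[p^∞]^{Gal(ℚ̄/ℚ_n)} ≤ p^k`
as a hypothesis. Here it is DISCHARGED with `k = v_p(#E(ℚ)_tors)`: at an odd MULTIPLICATIVE prime the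
`p`-power torsion does not grow in the cyclotomic tower — the tree's `E(ℚ_∞)[p^∞] = E(ℚ)[p^∞]` on the
Tate line (`X2.GreenbergVatsalTateDatumTorsion.smul_eq_of_mem_fixedPoints_kerSubgroup`, Greenberg LNM 1716
p. 62 / GV p. 26, from the PUBLISHED twisted Tate uniformisation, DISCHARGED in the tree) and Galois
descent (`X1.GeneratorCountTorsion.natCard_fixedPoints_le_pow_factorization_torsionOrder`).

* `natCard_fixedBy_layerSubgroup_le_pow_factorization_torsionOrder` — `#E[p^∞]^{Gal(ℚ̄/ℚ_n)} ≤ p^{v_p(#E(ℚ)_tors)}`.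
* `X2.algebraicLambdaGE_layer_of_analyticMuLE` — for `W/ℚ` globally minimal, `p` odd multiplicative
  with `E[p]` reducible, `μ_an ≤ m'` (`X2.AnalyticMuLE W p m'`), `S` census rows (`v ∤ p`,
  `v_p(N(v)^{p−1} − 1) = m_v + 1`, `p ∣ c_v`): `AlgebraicLambdaGE W p (Σ_v p^{min(n,m_v)} − pⁿm' −
  2·v_p(#E(ℚ)_tors))` for EVERY layer `n`, modulo Poitou–Tate / Euler–Poincaré over `ℚ_n`, Greenberg
  Prop. 4.15 (ii), Wuthrich Thm. 16, modularity BY NAME. At the étale end `W₀` of a type-A split class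
  (`m' = 0` by `stub_analyticMuZero_offLocus`, `v_p(#tors) = 1`, `n ≥ max m_v`): `λ_alg ≥ Σ_v s_v − 2`.

References: [GreenbergLNM1716] §1 p. 62, §3 p. 86, §5 pp. 114–118, p. 137, Prop. 4.15 (ii);
[GreenbergVatsal2000] §2 pp. 26, 28; [SilvermanATAEC1994] V Thm. 5.3, Cor. 5.4; [Wuthrich2014] Thm. 16.
-/

set_option autoImplicit false
-- `Summit.BirchSwinnertonDyer.BirchSwinnertonDyer.…`: the summit and its single sub-problem share a name (D-0017 layout).
set_option linter.dupNamespace false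

noncomputable section

open scoped Classical

open Function Field NumberField IsDedekindDomain WeierstrassCurve PowerSeries
  Literature.NumberTheory.EllipticCurves Literature.NumberTheory.GaloisRepresentations
  Literature.NumberTheory.GaloisCohomology Summit.BirchSwinnertonDyer.Rank1Residual.GaloisImage
  Literature.NumberTheory.EllipticCurves.IwasawaAlgebra
  Summit.BirchSwinnertonDyer.Rank1Residual.Additive
  Summit.BirchSwinnertonDyer.Rank1Residual.Additive.ZpTower
  Summit.BirchSwinnertonDyer.Rank1Residual.X1
  Summit.BirchSwinnertonDyer.Rank1Residual.X1.GeneratorBoundMuLayer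
  Summit.BirchSwinnertonDyer.BirchSwinnertonDyer.Theorems.EisensteinPrimesX2TowerBudgetTorsion

namespace Summit.BirchSwinnertonDyer.BirchSwinnertonDyer.Theorems.EisensteinPrimesX2TowerBudgetTorsionDischarged

variable {W : WeierstrassCurve ℚ} [W.IsElliptic] [W.IsGloballyMinimal] {p : ℕ} [hp : Fact p.Prime]

/-! ## §1. The layer torsion certificate at `p ‖ N`: `E(ℚ_n)[p^∞] = E(ℚ)[p^∞]`; the discharged budget -/

section LayerTorsion

open Summit.BirchSwinnertonDyer.Rank1Residual
  Summit.BirchSwinnertonDyer.Rank1Residual.X2.GreenbergVatsalTransferMultiplicative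
  Summit.BirchSwinnertonDyer.Rank1Residual.X1.TamagawaSqueeze
  Summit.BirchSwinnertonDyer.Rank1Residual.X1.GeneratorSqueeze
  Summit.BirchSwinnertonDyer.BirchSwinnertonDyer.Theorems.EisensteinPrimesAlgebraicLambdaGEBudget
  Literature.NumberTheory.EllipticCurves.Wuthrich2014
  Literature.NumberTheory.EllipticCurves.Greenberg1999
  Literature.NumberTheory.EllipticCurves.ModularForms

/-- **No `p`-power torsion growth in the cyclotomic tower at an odd MULTIPLICATIVE prime:
`#E[p^∞]^{Gal(ℚ̄/ℚ_n)} ≤ p^{v_p(#E(ℚ)_tors)}` for every layer `n`.** Every point of `E[p^∞]` fixed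
by `Gal(ℚ̄/ℚ_n) ⊇ Gal(ℚ̄/ℚ_∞)` is fixed by `Γ_ℚ` (the tree's `E(ℚ_∞)[p^∞] = E(ℚ)[p^∞]` at a Tate
prime, `X2.GreenbergVatsalTateDatumTorsion.smul_eq_of_mem_fixedPoints_kerSubgroup`, fed by the PUBLISHED
twisted Tate uniformisation DISCHARGED in the tree, `TateCurve.Silverman1994_thmV53_corV54_tateUniformisation_holds`),
and `#E[p^∞]^{Γ_ℚ} ≤ p^{v_p(#E(ℚ)_tors)}` by Galois descent
(`X1.GeneratorCountTorsion.natCard_fixedPoints_le_pow_factorization_torsionOrder`). So the layer-`n`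
torsion certificate `hB` of §2–§3 is `k = v_p(#E(ℚ)_tors)` (`= 1` at the étale end of a type-A split class
without rational `p²`-torsion). [cite: GreenbergLNM1716, §1 p. 62; §3 p. 86 (Lemma 3.1)]
[cite: GreenbergVatsal2000, §2 p. 26] [cite: SilvermanATAEC1994, Ch. V Thm. 5.3, Cor. 5.4] -/
theorem natCard_fixedBy_layerSubgroup_le_pow_factorization_torsionOrder (hodd : p ≠ 2)
    (hmult : W.HasMultiplicativeReductionAtPrime p) (κ : ZpExtension ℚ p) (hκ : κ.IsCyclotomic)
    (n : ℕ) :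
    Nat.card {b : geomPrimaryTorsion W p //
        ∀ σ : Field.absoluteGaloisGroup ℚ, σ ∈ κ.layerSubgroup n → σ • b = b} ≤
      p ^ (W.torsionOrder).factorization p := by
  -- the place above `p` and the twisted Tate uniformisation there (PUBLISHED, `_holds`)
  set v : HeightOneSpectrum (𝓞 ℚ) := (Rat.HeightOneSpectrum.primesEquiv (R := 𝓞 ℚ)).symm ⟨p, hp.out⟩
    with hvdef
  have hv : ((p : ℕ) : 𝓞 ℚ) ∈ v.asIdeal :=
    (natCast_mem_asIdeal_iff_eq_primesEquiv_symm v hp.out).mpr hvdef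
  have hmultv : W.HasMultiplicativeReductionAt v :=
    hasMultiplicativeReductionAt_of_natCast_mem W p hmult hv
  obtain ⟨q, t, Ψ, hq0, hq1, -, ht2, hsurj, hker, hΨσ, -⟩ :=
    TateCurve.Silverman1994_thmV53_corV54_tateUniformisation_holds W v hmultv
  have ht := X2.GreenbergVatsalTateDatumRat.inertia_fix_sqrt_gamma W hodd hmult hv t ht2
  have hΨ : ∀ (σ : absoluteGaloisGroup (v.adicCompletion ℚ))
      (u : (AlgebraicClosure (v.adicCompletion ℚ))ˣ),
      σ • Ψ (Additive.ofMul u) = Ψ (Additive.ofMul (Units.map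
        (Field.absoluteGaloisGroup.toAlgEquiv (v.adicCompletion ℚ) σ :
          AlgebraicClosure (v.adicCompletion ℚ) →* AlgebraicClosure (v.adicCompletion ℚ)) u)) ∨
      σ • Ψ (Additive.ofMul u) = -Ψ (Additive.ofMul (Units.map
        (Field.absoluteGaloisGroup.toAlgEquiv (v.adicCompletion ℚ) σ :
          AlgebraicClosure (v.adicCompletion ℚ) →* AlgebraicClosure (v.adicCompletion ℚ)) u)) := by
    intro σ u
    rw [hΨσ σ u]
    split_ifs
    · exact Or.inl (one_zsmul _)
    · exact Or.inr (neg_one_zsmul _)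
  have hΨI : ∀ σ ∈ absInertia (v.adicCompletion ℚ),
      ∀ u : (AlgebraicClosure (v.adicCompletion ℚ))ˣ,
      σ • Ψ (Additive.ofMul u) = Ψ (Additive.ofMul (Units.map
        (Field.absoluteGaloisGroup.toAlgEquiv (v.adicCompletion ℚ) σ :
          AlgebraicClosure (v.adicCompletion ℚ) →* AlgebraicClosure (v.adicCompletion ℚ)) u)) := by
    intro σ hσ u
    rw [hΨσ σ u, if_pos (ht σ hσ), one_zsmul]
  -- every `Gal(ℚ̄/ℚ_n)`-fixed point is `Γ_ℚ`-fixed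
  have key : ∀ b : geomPrimaryTorsion W p,
      (∀ σ : Field.absoluteGaloisGroup ℚ, σ ∈ κ.layerSubgroup n → σ • b = b) →
      ∀ σ : Field.absoluteGaloisGroup ℚ, σ • b = b := by
    intro b hb σ
    have hb' : b ∈ FixedPoints.addSubgroup κ.kerSubgroup (geomPrimaryTorsion W p) :=
      (FixedPoints.mem_addSubgroup _ _ _).mpr fun τ ↦ by
        rw [Subgroup.smul_def]; exact hb τ (κ.kerSubgroup_le_layerSubgroup n τ.2)
    exact X2.GreenbergVatsalTateDatumTorsion.smul_eq_of_mem_fixedPoints_kerSubgroup W p Ψ hΨ hq0 hq1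
      (fun u h ↦ (hker u).1 h) hΨI κ hκ hodd hv hsurj σ hb'
  -- count through the injection into the `Γ_ℚ`-fixed points
  haveI : Finite {a : geomPrimaryTorsion W p // ∀ σ : Field.absoluteGaloisGroup ℚ, σ • a = a} :=
    (W.finite_fixedPoints_geomPrimaryTorsion p).to_subtype
  refine (Nat.card_le_card_of_injective
    (fun b : {b : geomPrimaryTorsion W p //
        ∀ σ : Field.absoluteGaloisGroup ℚ, σ ∈ κ.layerSubgroup n → σ • b = b} ↦
      (⟨b.1, key b.1 b.2⟩ : {a : geomPrimaryTorsion W p // ∀ σ : Field.absoluteGaloisGroup ℚ, σ • a = a}))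
    (fun b b' h ↦ Subtype.ext (by simpa using congrArg Subtype.val h))).trans ?_
  exact X1.GeneratorCountTorsion.natCard_fixedPoints_le_pow_factorization_torsionOrder W p

/-- **The TOWER budget at `p ‖ N` with every input DISCHARGED to per-pair integer data** (stub
`stub_lambdaCount_offLocus`, algebraic conjunct): `W/ℚ` globally minimal, `p` odd of multiplicative
reduction with `E[p]` reducible, a member with `μ_an ≤ m'` (`X2.AnalyticMuLE W p m'`), and a finite set
`S` of places `v ∤ p` with the census columns `v_p(N(v)^{p−1} − 1) = m_v + 1`, `p ∣ c_v(E)`. Then for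
every layer `n`:
**`AlgebraicLambdaGE W p (Σ_{v∈S} p^{min(n, m_v)} − pⁿ m' − 2·v_p(#E(ℚ)_tors))`**, modulo the named
PUBLISHED facts Poitou–Tate / Euler–Poincaré over `ℚ_n` (`hPT`, `hEP`), Greenberg Prop. 4.15 (ii)
(`h415`), Wuthrich Thm. 16 (`hWu`), modularity (`hpar`). At the étale end `W₀` of a type-A split class
(`μ_an(W₀) = 0` = `stub_analyticMuZero_offLocus`, `v_p(#E(ℚ)_tors) = 1`, `n ≥ max m_v`):
`λ(X(W₀/ℚ_∞)) ≥ Σ_{v∈S} s_v − 2`, the Greenberg–Vatsal type-A count on the Tamagawa rows (GV p. 28,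
«λ_E ≥ Σ δ_ℓ») WITHOUT the layer-`0` restriction `s_v = 1` of p480562 / p547788.
[cite: GreenbergLNM1716, §5 pp. 114–118 (proof of Cor. 5.6), p. 137, Prop. 4.15 (ii)]
[cite: GreenbergVatsal2000, §2 p. 28] [cite: Wuthrich2014, Thm. 16 (p. 397)] [cite: Washington1997, §13.1] -/
theorem X2.algebraicLambdaGE_layer_of_analyticMuLE (hodd : p ≠ 2)
    (hWu : thm16_charIdeal_dvd_multiplicative_of_reducible)
    (hpar : nonempty_modularParametrizationData)
    (h415 : prop415ii_noFiniteSubmodule_of_ordinary_or_multiplicative)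
    (hmult : W.HasMultiplicativeReductionAtPrime p) (hred : ¬ W.HasIrreducibleModPGaloisRep p)
    {m' : ℕ} (hμ : X2.AnalyticMuLE W p m') (n : ℕ)
    (hPT : ∀ (κ : ZpExtension ℚ p) [NumberField (κ.layer n)], κ.IsCyclotomic →
      poitouTate_selmerStructure_duality (κ.layer n))
    (hEP : ∀ (κ : ZpExtension ℚ p) [NumberField (κ.layer n)], κ.IsCyclotomic →
      ∀ w : HeightOneSpectrum (𝓞 (κ.layer n)),
      localEulerPoincareCharacteristic (w.adicCompletion (κ.layer n)))
    (S : Finset (HeightOneSpectrum (𝓞 ℚ))) (m : HeightOneSpectrum (𝓞 ℚ) → ℕ)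
    (hSp : ∀ v ∈ S, ((p : ℕ) : 𝓞 ℚ) ∉ v.asIdeal)
    (hval : ∀ v ∈ S, padicValNat p (v.residueCard ^ (p - 1) - 1) = m v + 1)
    (hcv : ∀ v ∈ S,
      p ∣ (W.baseChange (v.adicCompletion ℚ)).localTamagawaNumber (v.adicCompletionIntegers ℚ)) :
    AlgebraicLambdaGE W p
      (∑ v ∈ S, p ^ min n (m v) - p ^ n * m' - 2 * (W.torsionOrder).factorization p) :=
  X2.algebraicLambdaGE_layer_of_analyticMuLE_of_layerTorsion hodd hWu hpar h415 hmult hred hμ n hPT hEP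
    (fun κ hκ ↦ natCard_fixedBy_layerSubgroup_le_pow_factorization_torsionOrder hodd hmult κ hκ n)
    S m hSp hval hcv

end LayerTorsion

end Summit.BirchSwinnertonDyer.BirchSwinnertonDyer.Theorems.EisensteinPrimesX2TowerBudgetTorsionDischarged

end
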